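import Literature.NumberTheory.Automorphic.Liu2021.AppendixC.Glue
import HarnessLib

/-!
# The field projections of `toThm418Data C R` are those of `C` / `R` — `rfl` lemmas
# ([Liu2021] §4.2 l. 2053–2074 and Thm. 4.18, as assembled from Appendix C by `AppendixC.Glue.toThm418Data`)

Topic `NumberTheory/Automorphic/Liu2021/AppendixC`; namespace `Literature.NumberTheory.Automorphic.Liu2021.AppendixC.Sec42Data`
(next to the tree's `Sec42Data.toThm418Data_G` / `Sec42Data.toThm418Data_HomK` of `Glue.lean` :569 / :572).  THEOREMS ONLY, every body
`rfl` / `Iff.rfl` (no definition, no named fact, no instance, no `sorry`); imports ★ `AppendixC.Glue` only; books 0.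

WHY THIS LEAF (cell hodgecm-mathlib, A-plan1 (g9) «GO-TYPE» 2026-08-29T05:33:34Z; A-p18 (g8) census ED-MGG-HB part 2, A-p19 (g9)
edition 3 of `CorCM/HypLiu418/A3Liu418MainGaloisGlue.lean`): the 3.5 M-heartbeat step of `mainGalois_D0_of` is an elaborator
`isDefEq` between the `RestOne`/`UV`/`TV` spelling of the output of (G1) `exists_mainIso_of_etaleItems` and the
`D₀`-projection spelling `(toThm418Data ℭ_V ((muConj 𝕌_V).rest t_ν)).field` that (G2)
`Thm418Data.epsBlock_galoisAct_stable_of_epsRigid` / `MainGalois D₀` expect; every such projection is unfolded against the family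
terms.  The cure of record names «a set of `rfl` projection lemmas `toThm418Data_Ω/_μ/_G/_rhoΩ/_omegaAt/_rhoAt`» to be rewritten into
the hypotheses before the application (one unification instead of two).  This file is that rewrite set, for EVERY data field of
`Thm418Data` and for the derived `cmType` / `IsAdmissible` / `omegaAt` / `rhoAt`; the restatement of (G1) in `D₀`-spelling is the
consumer's (cone file), not done here.  0 importers today.

## What is typed (all `rfl`; `D₀ := toThm418Data C R`, `C : Sec42Data P5 isotropicAt`, `R : Thm418Rest C`)

* carriers: `toThm418Data_n : D₀.n = P5.n` · `toThm418Data_𝕍 : D₀.𝕍 = P5.𝕍` · `toThm418Data_Eps` · `toThm418Data_epsOf` ·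
  `toThm418Data_Chi` · `toThm418Data_μ : D₀.μ = R.μ` · `toThm418Data_Obj` · `toThm418Data_omega (ε χ) : D₀.omega ε χ = R.omega ε χ` ·
  `toThm418Data_rho (ε χ) : D₀.rho ε χ = R.rho ε χ` · `toThm418Data_Ω : D₀.Ω = R.Ω` · `toThm418Data_rhoΩ : D₀.rhoΩ = R.rhoΩ` ·
  `toThm418Data_res (K D) : D₀.res K D = R.res (C.levelOf K) D` (the tree already has `toThm418Data_G : D₀.G = C.G` and
  `toThm418Data_HomK : D₀.HomK K D = C.HomQ (C.levelOf K) (R.Aμ D)`, not restated);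
* derived: `toThm418Data_cmType : D₀.cmType = Φ_μ of R.μ` · `toThm418Data_isAdmissible_iff` ·
  `toThm418Data_omegaAt (i) : D₀.omegaAt i = R.omega i.1.1 i.1.2` · `toThm418Data_rhoAt (i) : D₀.rhoAt i = R.rho i.1.1 i.1.2`.

The two sides of each equation have SYNTACTICALLY different but definitionally equal types (e.g. `Representation (fieldOfValues E D₀.μ)
D₀.G D₀.Ω` vs `Representation (fieldOfValues E R.μ) C.G R.Ω`, the instances being the projections `D₀.instAddCommGroupΩ = R.instAddCommGroupΩ`
etc.); the elaborator closes them by projection-of-constructor reduction, which is exactly the cheap path a consumer buys by rewriting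
with these lemmas first.

## References
* [Liu2021] Y. Liu, *Fourier–Jacobi cycles and arithmetic relative trace formula*, Camb. J. Math. 9 (2021) = arXiv:2102.11518:
  §4.2 l. 2053–2074 (the standing data), Def. 4.11–4.12 (`ω(μ,ε,χ)`, admissible `ε`), Def. 4.16 / Rem. 4.17 (`Ω(μ)`), Thm. 4.18.
-/

noncomputable section

open NumberField
open Literature.AlgebraicGeometry.Motives (CMType)
open Literature.AlgebraicGeometry.Liu2021 (IsAdmissibleElement)

namespace Literature.NumberTheory.Automorphic.Liu2021.AppendixC

variable {F E : Type} [Field F] [NumberField F] [IsTotallyReal F] [Field E] [NumberField E] [Algebra F E]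
  [IsTotallyComplex E] [Algebra.IsQuadraticExtension F E]

namespace Sec42Data

variable {P5 : PropC5Data F E} {isotropicAt : ℕ → Prop} (C : Sec42Data P5 isotropicAt) (R : Thm418Rest C)

/-! ### The carriers of `toThm418Data C R` -/

/-- The rank `n` of `toThm418Data C R` is Appendix C's `P5.n` (by `rfl`). [cite: Liu2021, §4.2 l. 2053] -/
theorem toThm418Data_n : (toThm418Data C R).n = P5.n := rfl

/-- The token `𝕍` of `toThm418Data C R` is Appendix C's `P5.𝕍` (by `rfl`). [cite: Liu2021, §4.2 l. 2053; Def. C.3] -/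
theorem toThm418Data_𝕍 : (toThm418Data C R).𝕍 = P5.𝕍 := rfl

/-- The collections `ε` of `toThm418Data C R` are `R.Eps` (by `rfl`). [cite: Liu2021, Def. 4.11] -/
theorem toThm418Data_Eps : (toThm418Data C R).Eps = R.Eps := rfl

/-- `e ↦ (e · Nm)_v` of `toThm418Data C R` is `R.epsOf` (by `rfl`). [cite: Liu2021, Def. 4.12] -/
theorem toThm418Data_epsOf : (toThm418Data C R).epsOf = R.epsOf := rfl

/-- pointwise form of `toThm418Data_epsOf`. [cite: Liu2021, Def. 4.12] -/
theorem toThm418Data_epsOf_apply (e : E) : (toThm418Data C R).epsOf e = R.epsOf e := rfl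

/-- The characters `χ` of `toThm418Data C R` are `R.Chi` (by `rfl`). [cite: Liu2021, Def. 4.11] -/
theorem toThm418Data_Chi : (toThm418Data C R).Chi = R.Chi := rfl

/-- The character `μ` of `toThm418Data C R` is `R.μ` (by `rfl`). [cite: Liu2021, Def. 4.16] -/
theorem toThm418Data_μ : (toThm418Data C R).μ = R.μ := rfl

/-- The objects `D_μ ∈ 𝒜(μ)` of `toThm418Data C R` are `R.Obj` (by `rfl`). [cite: Liu2021, Def. 4.5 (2)–(3)] -/
theorem toThm418Data_Obj : (toThm418Data C R).Obj = R.Obj := rfl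

/-- The spaces `ω(μ, ε, χ)` of `toThm418Data C R` are `R.omega` (by `rfl`). [cite: Liu2021, Def. 4.11] -/
theorem toThm418Data_omega (ε : (toThm418Data C R).Eps) (χ : (toThm418Data C R).Chi) :
    (toThm418Data C R).omega ε χ = R.omega ε χ := rfl

/-- The `𝔾(𝔸_F^∞)`-actions on `ω(μ, ε, χ)` of `toThm418Data C R` are `R.rho` (by `rfl`; both sides are representations of the
same group `C.G = (toThm418Data C R).G`, `toThm418Data_G`). [cite: Liu2021, Def. 4.11] -/
theorem toThm418Data_rho (ε : (toThm418Data C R).Eps) (χ : (toThm418Data C R).Chi) :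
    (toThm418Data C R).rho ε χ = R.rho ε χ := rfl

/-- pointwise form of `toThm418Data_rho`: the operator of `g`. [cite: Liu2021, Def. 4.11] -/
theorem toThm418Data_rho_apply (ε : (toThm418Data C R).Eps) (χ : (toThm418Data C R).Chi) (g : C.G) :
    (toThm418Data C R).rho ε χ g = R.rho ε χ g := rfl

/-- The module `Ω(μ)` of `toThm418Data C R` is `R.Ω` (by `rfl`). [cite: Liu2021, Def. 4.16] -/
theorem toThm418Data_Ω : (toThm418Data C R).Ω = R.Ω := rfl

/-- The `𝔾(𝔸_F^∞)`-action on `Ω(μ)` of `toThm418Data C R` is `R.rhoΩ` (by `rfl`). [cite: Liu2021, Def. 4.16, l. 2219] -/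
theorem toThm418Data_rhoΩ : (toThm418Data C R).rhoΩ = R.rhoΩ := rfl

/-- pointwise form of `toThm418Data_rhoΩ`: the operator of `g`. [cite: Liu2021, Def. 4.16, l. 2219] -/
theorem toThm418Data_rhoΩ_apply (g : C.G) : (toThm418Data C R).rhoΩ g = R.rhoΩ g := rfl

/-- The canonical maps `Hom_E(A_K, A_μ)_ℚ → Ω(μ)` of `toThm418Data C R` are `R.res` at the level `C.levelOf K` (by `rfl`; companion
of the tree's `toThm418Data_HomK`). [cite: Liu2021, §4.2 l. 2070–2072; Rem. 4.17] -/
theorem toThm418Data_res (K : Subgroup C.G) (D : R.Obj) :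
    (toThm418Data C R).res K D = R.res (C.levelOf K) D := rfl

/-! ### The derived data: `Φ_μ`, admissible `ε`, `ω_i`, `ρ_i` -/

/-- The CM type `Φ_μ` of `toThm418Data C R` is that of `R.μ` (by `rfl`). [cite: Liu2021, Def. 4.3 (2)] -/
theorem toThm418Data_cmType :
    (toThm418Data C R).cmType = (letI : IsCMField E := isCMField F E; R.isConjugateSymplectic.cmType) := rfl

/-- «`ε` is `μ`-admissible» for `toThm418Data C R`, unfolded on `R` (by `Iff.rfl`). [cite: Liu2021, Def. 4.12] -/
theorem toThm418Data_isAdmissible_iff (ε : (toThm418Data C R).Eps) :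
    (toThm418Data C R).IsAdmissible ε ↔
      ∃ e : E, (letI : IsCMField E := isCMField F E;
        IsAdmissibleElement E (R.isConjugateSymplectic.cmType).1 e) ∧ R.epsOf e = ε :=
  Iff.rfl

/-- `ω_i` of `toThm418Data C R` at an admissible index `i = (ε, χ)` is `R.omega ε χ` (by `rfl`). [cite: Liu2021, Thm. 4.18] -/
theorem toThm418Data_omegaAt (i : (toThm418Data C R).AdmIndex) :
    (toThm418Data C R).omegaAt i = R.omega i.1.1 i.1.2 := rfl

/-- `ρ_i` of `toThm418Data C R` at an admissible index `i = (ε, χ)` is `R.rho ε χ` (by `rfl`). [cite: Liu2021, Thm. 4.18; Def. 4.11] -/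
theorem toThm418Data_rhoAt (i : (toThm418Data C R).AdmIndex) :
    (toThm418Data C R).rhoAt i = R.rho i.1.1 i.1.2 := rfl

/-- pointwise form of `toThm418Data_rhoAt`. [cite: Liu2021, Thm. 4.18; Def. 4.11] -/
theorem toThm418Data_rhoAt_apply (i : (toThm418Data C R).AdmIndex) (g : C.G) :
    (toThm418Data C R).rhoAt i g = R.rho i.1.1 i.1.2 g := rfl

end Sec42Data

end Literature.NumberTheory.Automorphic.Liu2021.AppendixC

end
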